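import Mathlib
import Literature.Analysis.Asymptotics.KaramataTauberianLaplace
import HarnessLib

/-!
# Karamata's Tauberian theorem for Laplace transforms, index `ρ = 2`

Topic `Literature/Analysis/Asymptotics`. Everything in this file is PROVED. Companion of
`KaramataTauberianLaplace.lean` (index `ρ = 1` with a slowly varying factor): here `ρ = 2` and the
slowly varying factor is trivial, which is the case needed to pass from an ABEL limit of
`∫₀^∞ e^{-νt} C(t) dt` to the order-2 Riesz (Cesàro) mean of `C` when the doubly integrated
`V(t) = ∫₀ᵗ (t-u) C(u) du` is non-negative (Tauberian step of Green–Kubo-type arguments).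

Statement (Feller, *An Introduction to Probability Theory and Its Applications* II, XIII.5
Theorem 2, `ρ = 2`, direction (5.15) ⟹ (5.16), density form): for `u ≥ 0` on `(0,∞)` with
`ω(δ) = ∫₀^∞ u(t) e^{-δt} dt` finite for every `δ > 0`, if `δ² ω(δ) → A` as `δ ↓ 0` then
`T⁻² ∫₀ᵀ u(t) dt → A/2 = A/Γ(3)` as `T → ∞` (`karamata_tauberian_laplace_two`).

Proof: Karamata's polynomial method, line by line as in the index-`1` file:
* `∫₀^∞ u(t) P(e^{-t/T}) dt = Σ_r p_r ω(r/T)` (`KaramataLaplace.integral_mul_eval`) and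
  `ω(r/T)/T² = r⁻² (r/T)² ω(r/T) → A/r²`, so `T⁻² ∫₀^∞ u(t) P(e^{-t/T}) dt → A Λ₂(P)` with
  `Λ₂(P) = Σ_r p_r / r²` for `P(0) = 0` (written out as a `Finset.sum`, no new definition);
* `Λ₂(P) = ∫₀^∞ t P(e^{-t}) dt` (the case `u(t) = t`, `T = 1`; `∫₀^∞ t e^{-rt} dt = r⁻²`);
* Karamata's one-sided approximants `P₋ ≤ χ_J ≤ P₊` of `J = [e⁻¹, 1]`
  (`Literature.NumberTheory.LFunctions.KaramataPolynomials_holds`, MV Lemma 5.8) satisfy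
  `|Λ₂(P±) - 1/2| ≤ 22 ε` (`∫₀¹ t dt = 1/2`, `∫ t χ_K(e^{-t}) dt = 2ε`,
  `∫ t e^{-t}(1 - e^{-t}) dt = 3/4`), and sandwich `T⁻² ∫₀ᵀ u`.
Deliberately NOT here: general `ρ`, slowly varying factors, the converse (Abelian) direction.

## References

* W. Feller, *An Introduction to Probability Theory and Its Applications, Vol. II*, 2nd ed., Wiley
  1971, ch. XIII §5, Theorem 2. [cite: Feller1971]
* H. L. Montgomery, R. C. Vaughan, *Multiplicative Number Theory I*, CUP 2007, §5.2 (Karamata's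
  method, Lemma 5.8, Theorem 5.7). [cite: MontgomeryVaughan2007]
-/

noncomputable section

open MeasureTheory Filter Set Polynomial
open Literature.NumberTheory.LFunctions Literature.NumberTheory.LFunctions.Karamata
open scoped Topology

namespace Literature.Analysis.Asymptotics

namespace KaramataLaplace

variable {u : ℝ → ℝ} {A : ℝ}

/-! ### Step 1: polynomials of `e^{-t/T}` against `u`, index 2 -/

/-- The key limit at index `2`: for `r ≥ 1`, `ω(r/T) / T² → A / r²` as `T → ∞` when
`δ² ω(δ) → A` (`δ ↓ 0`). [cite: Feller1971, XIII.5 Theorem 2 (ρ = 2, proof idea (5.2)–(5.3))] -/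
theorem tendsto_laplace_div_sq {r : ℕ} (hr : 0 < r)
    (hω : Tendsto (fun δ : ℝ => δ ^ 2 * laplace u δ) (𝓝[>] 0) (𝓝 A)) :
    Tendsto (fun T : ℝ => laplace u (r / T) / T ^ 2) atTop (𝓝 (A / (r : ℝ) ^ 2)) := by
  have hr0 : (0 : ℝ) < r := Nat.cast_pos.mpr hr
  -- δ(T) = r/T → 0⁺
  have hδ : Tendsto (fun T : ℝ => (r : ℝ) / T) atTop (𝓝[>] 0) := by
    rw [tendsto_nhdsWithin_iff]
    refine ⟨tendsto_const_nhds.div_atTop tendsto_id, ?_⟩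
    filter_upwards [eventually_gt_atTop 0] with T hT
    exact div_pos hr0 hT
  have h1 : Tendsto (fun T : ℝ => ((r : ℝ) / T) ^ 2 * laplace u (r / T)) atTop (𝓝 A) :=
    hω.comp hδ
  have h3 := h1.mul_const (((r : ℝ) ^ 2)⁻¹)
  rw [← div_eq_mul_inv] at h3
  refine h3.congr' ?_
  filter_upwards [eventually_gt_atTop 0] with T hT
  have hT' : T ≠ 0 := hT.ne'
  have hr' : (r : ℝ) ≠ 0 := hr0.ne'
  field_simp

/-- `∫₀^∞ u(t) P(e^{-t/T}) dt / T² → A Λ₂(P)` for `P(0) = 0`, where `Λ₂(P) = Σ_r p_r / r²`.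
[cite: MontgomeryVaughan2007, (5.43) p. 124 (with r⁻² in place of r⁻¹)] -/
theorem tendsto_integral_mul_eval_sq (P : ℝ[X]) (hP0 : P.eval 0 = 0)
    (hint : ∀ δ : ℝ, 0 < δ → IntegrableOn (fun t => u t * Real.exp (-(δ * t))) (Ioi 0))
    (hω : Tendsto (fun δ : ℝ => δ ^ 2 * laplace u δ) (𝓝[>] 0) (𝓝 A)) :
    Tendsto (fun T : ℝ => (∫ t in Ioi (0 : ℝ), u t * P.eval (Real.exp (-(t / T)))) / T ^ 2)
      atTop (𝓝 (A * ∑ r ∈ Finset.range (P.natDegree + 1), P.coeff r / (r : ℝ) ^ 2)) := by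
  have hev : ∀ᶠ T : ℝ in atTop, (∑ r ∈ Finset.range (P.natDegree + 1),
      P.coeff r * (laplace u (r / T) / T ^ 2)) =
      (∫ t in Ioi (0 : ℝ), u t * P.eval (Real.exp (-(t / T)))) / T ^ 2 := by
    filter_upwards [eventually_gt_atTop 0] with T hT
    rw [(integral_mul_eval P hP0 hint hT).2, Finset.sum_div]
    refine Finset.sum_congr rfl fun r _ => ?_
    ring
  refine Tendsto.congr' hev ?_
  have hlam : A * ∑ r ∈ Finset.range (P.natDegree + 1), P.coeff r / (r : ℝ) ^ 2 =
      ∑ r ∈ Finset.range (P.natDegree + 1), P.coeff r * (A / (r : ℝ) ^ 2) := by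
    rw [Finset.mul_sum]
    refine Finset.sum_congr rfl fun r _ => ?_
    ring
  rw [hlam]
  refine tendsto_finsetSum _ fun r _ => ?_
  rcases Nat.eq_zero_or_pos r with rfl | hr
  · have : P.coeff 0 = 0 := by rwa [Polynomial.coeff_zero_eq_eval_zero]
    simp only [this, zero_mul]
    exact tendsto_const_nhds
  · exact (tendsto_laplace_div_sq hr hω).const_mul _

/-! ### Step 2: the comparison integrals (`u(t) = t`, `T = 1`) -/

/-- `t ↦ t e^{-δt}` is integrable on `(0,∞)` for `δ > 0`. [folklore] -/
theorem hint_id : ∀ δ : ℝ, 0 < δ →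
    IntegrableOn (fun t : ℝ => t * Real.exp (-(δ * t))) (Ioi 0) := by
  intro δ hδ
  have h := integrableOn_rpow_mul_exp_neg_mul_rpow (s := 1) (p := 1) (by norm_num) le_rfl hδ
  refine h.congr_fun (fun t _ => ?_) measurableSet_Ioi
  simp only [Real.rpow_one, neg_mul]

/-- `∫₀^∞ t e^{-δt} dt = 1/δ²` (`Γ(2) = 1`). [folklore] -/
theorem laplace_id {δ : ℝ} (hδ : 0 < δ) : laplace (fun t : ℝ => t) δ = 1 / δ ^ 2 := by
  unfold laplace
  have h := Real.integral_rpow_mul_exp_neg_mul_Ioi (a := 2) (r := δ) two_pos hδ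
  have h2 : Real.Gamma 2 = 1 := by simp
  rw [h2, mul_one] at h
  have h3 : ∫ t in Ioi (0 : ℝ), t * Real.exp (-(δ * t)) =
      ∫ t in Ioi (0 : ℝ), t ^ ((2 : ℝ) - 1) * Real.exp (-(δ * t)) := by
    refine setIntegral_congr_fun measurableSet_Ioi (fun t _ => ?_)
    norm_num
  rw [h3, h, Real.rpow_two, one_div, inv_pow, one_div]

/-- `Λ₂(P) = ∫₀^∞ t P(e^{-t}) dt` for `P(0) = 0`, and the integrand is integrable. [folklore] -/
theorem integral_id_mul_eval_exp_neg (P : ℝ[X]) (hP0 : P.eval 0 = 0) :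
    IntegrableOn (fun t => t * P.eval (Real.exp (-t))) (Ioi 0) ∧
      ∫ t in Ioi (0 : ℝ), t * P.eval (Real.exp (-t)) =
        ∑ r ∈ Finset.range (P.natDegree + 1), P.coeff r / (r : ℝ) ^ 2 := by
  have h := integral_mul_eval (u := fun t : ℝ => t) P hP0 hint_id one_pos
  simp only [div_one] at h
  refine ⟨h.1, ?_⟩
  rw [h.2]
  refine Finset.sum_congr rfl fun r _ => ?_
  rcases Nat.eq_zero_or_pos r with rfl | hr
  · have : P.coeff 0 = 0 := by rwa [Polynomial.coeff_zero_eq_eval_zero]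
    simp [this]
  · rw [laplace_id (Nat.cast_pos.mpr hr)]
    ring

/-- `∫₀^∞ t χ_J(e^{-t}) dt = ∫₀¹ t dt = 1/2`. [folklore] -/
theorem integral_id_mul_chiJ_exp_neg :
    IntegrableOn (fun t => t * chiJ (Real.exp (-t))) (Ioi 0) ∧
      ∫ t in Ioi (0 : ℝ), t * chiJ (Real.exp (-t)) = 1 / 2 := by
  have hfun : (fun t => t * chiJ (Real.exp (-t))) = (Iic (1 : ℝ)).indicator fun t => t := by
    ext t
    simp only [chiJ_exp_neg, Set.indicator_apply, Set.mem_Iic]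
    split_ifs <;> simp
  rw [hfun]
  refine ⟨?_, ?_⟩
  · rw [IntegrableOn, integrable_indicator_iff measurableSet_Iic]
    rw [IntegrableOn, Measure.restrict_restrict measurableSet_Iic, Iic_inter_Ioi]
    exact (continuous_id.integrableOn_Icc (a := 0) (b := 1)).mono_set Ioc_subset_Icc_self
  · rw [setIntegral_indicator measurableSet_Iic, Ioi_inter_Iic,
      ← intervalIntegral.integral_of_le zero_le_one, integral_id]
    norm_num

/-- `∫₀^∞ t χ_K(e^{-t}) dt = ∫_{1-ε}^{1+ε} t dt = 2ε` for `0 < ε < 1`. [folklore] -/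
theorem integral_id_mul_chiK_exp_neg {ε : ℝ} (hε : 0 < ε) (hε1 : ε < 1) :
    IntegrableOn (fun t => t * chiK ε (Real.exp (-t))) (Ioi 0) ∧
      ∫ t in Ioi (0 : ℝ), t * chiK ε (Real.exp (-t)) = 2 * ε := by
  have hfun : (fun t => t * chiK ε (Real.exp (-t))) =
      (Icc (1 - ε) (1 + ε)).indicator fun t => t := by
    ext t
    simp only [chiK_exp_neg, Set.indicator_apply, Set.mem_Icc]
    split_ifs <;> simp
  have hsub : Icc (1 - ε) (1 + ε) ∩ Ioi (0 : ℝ) = Icc (1 - ε) (1 + ε) := by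
    refine Set.inter_eq_left.mpr fun t ht => ?_
    simp only [Set.mem_Ioi]
    linarith [ht.1]
  have hsub' : Ioi (0 : ℝ) ∩ Icc (1 - ε) (1 + ε) = Icc (1 - ε) (1 + ε) := by
    rw [Set.inter_comm, hsub]
  rw [hfun]
  refine ⟨?_, ?_⟩
  · rw [IntegrableOn, integrable_indicator_iff measurableSet_Icc]
    rw [IntegrableOn, Measure.restrict_restrict measurableSet_Icc, hsub]
    exact continuous_id.integrableOn_Icc
  · rw [setIntegral_indicator measurableSet_Icc, hsub', integral_Icc_eq_integral_Ioc,
      ← intervalIntegral.integral_of_le (by linarith), integral_id]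
    ring

/-- `∫₀^∞ t e^{-t}(1 - e^{-t}) dt = 1 - 1/4 = 3/4`. [folklore] -/
theorem integral_id_mul_exp_neg_mul_one_sub :
    IntegrableOn (fun t => t * (Real.exp (-t) * (1 - Real.exp (-t)))) (Ioi 0) ∧
      ∫ t in Ioi (0 : ℝ), t * (Real.exp (-t) * (1 - Real.exp (-t))) = 3 / 4 := by
  have h1 : IntegrableOn (fun t : ℝ => t * Real.exp (-(1 * t))) (Ioi 0) := hint_id 1 one_pos
  have h2 : IntegrableOn (fun t : ℝ => t * Real.exp (-(2 * t))) (Ioi 0) := hint_id 2 two_pos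
  have hfun : (fun t => t * (Real.exp (-t) * (1 - Real.exp (-t)))) =
      fun t => t * Real.exp (-(1 * t)) - t * Real.exp (-(2 * t)) := by
    ext t
    rw [mul_sub, mul_one, ← Real.exp_add, mul_sub]
    congr 2 <;> congr 1 <;> ring
  rw [hfun]
  refine ⟨h1.sub h2, ?_⟩
  have e1 := laplace_id one_pos
  have e2 := laplace_id two_pos
  unfold laplace at e1 e2
  rw [integral_sub h1 h2, e1, e2]
  norm_num

/-- For Karamata's polynomials at level `ε`: `Λ₂(P₋) ≤ 1/2 ≤ Λ₂(P₊)` and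
`Λ₂(P₊) - Λ₂(P₋) ≤ (3/2) ε + 20 ε ≤ 22 ε`, hence `|Λ₂(P±) - 1/2| ≤ 22 ε`.
[cite: MontgomeryVaughan2007, Lemma 5.8 (applied with weight t)] -/
theorem lam_sq_bounds {ε : ℝ} (hε : 0 < ε) (hε1 : ε < 1) {Pm Pp : ℝ[X]}
    (hPm0 : Pm.eval 0 = 0) (hPp0 : Pp.eval 0 = 0)
    (hP : ∀ x ∈ Icc (0 : ℝ) 1, Pm.eval x ≤ chiJ x ∧ chiJ x ≤ Pp.eval x ∧
      |Pm.eval x - chiJ x| ≤ ε * (x * (1 - x)) + 5 * chiK ε x ∧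
      |Pp.eval x - chiJ x| ≤ ε * (x * (1 - x)) + 5 * chiK ε x) :
    |(∑ r ∈ Finset.range (Pm.natDegree + 1), Pm.coeff r / (r : ℝ) ^ 2) - 1 / 2| ≤ 22 * ε ∧
      |(∑ r ∈ Finset.range (Pp.natDegree + 1), Pp.coeff r / (r : ℝ) ^ 2) - 1 / 2| ≤ 22 * ε := by
  obtain ⟨hiPm, hPm⟩ := integral_id_mul_eval_exp_neg Pm hPm0
  obtain ⟨hiPp, hPp⟩ := integral_id_mul_eval_exp_neg Pp hPp0
  obtain ⟨hiJ, hJ⟩ := integral_id_mul_chiJ_exp_neg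
  obtain ⟨hiK, hK⟩ := integral_id_mul_chiK_exp_neg hε hε1
  obtain ⟨hiA, hA⟩ := integral_id_mul_exp_neg_mul_one_sub
  rw [← hPm, ← hPp]
  have hxmem : ∀ t ∈ Ioi (0 : ℝ), Real.exp (-t) ∈ Icc (0 : ℝ) 1 := fun t ht =>
    ⟨(Real.exp_pos _).le, Real.exp_le_one_iff.mpr (by simp only [Set.mem_Ioi] at ht; linarith)⟩
  -- Λ₂(P₋) ≤ 1/2
  have h1 : (∫ t in Ioi (0 : ℝ), t * Pm.eval (Real.exp (-t))) ≤ 1 / 2 := by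
    rw [← hJ]
    exact setIntegral_mono_on hiPm hiJ measurableSet_Ioi fun t ht =>
      mul_le_mul_of_nonneg_left (hP _ (hxmem t ht)).1 (le_of_lt ht)
  -- 1/2 ≤ Λ₂(P₊)
  have h2 : 1 / 2 ≤ ∫ t in Ioi (0 : ℝ), t * Pp.eval (Real.exp (-t)) := by
    rw [← hJ]
    exact setIntegral_mono_on hiJ hiPp measurableSet_Ioi fun t ht =>
      mul_le_mul_of_nonneg_left (hP _ (hxmem t ht)).2.1 (le_of_lt ht)
  -- Λ₂(P₊) - Λ₂(P₋) ≤ 22 ε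
  have h3 : (∫ t in Ioi (0 : ℝ), t * Pp.eval (Real.exp (-t))) -
      (∫ t in Ioi (0 : ℝ), t * Pm.eval (Real.exp (-t))) ≤ 22 * ε := by
    have hdiff : ∀ t ∈ Ioi (0 : ℝ),
        t * Pp.eval (Real.exp (-t)) - t * Pm.eval (Real.exp (-t)) ≤
        2 * ε * (t * (Real.exp (-t) * (1 - Real.exp (-t)))) +
          10 * (t * chiK ε (Real.exp (-t))) := by
      intro t ht
      obtain ⟨-, -, h3, h4⟩ := hP _ (hxmem t ht)
      rw [abs_le] at h3 h4
      have ht0 : 0 ≤ t := le_of_lt ht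
      have : Pp.eval (Real.exp (-t)) - Pm.eval (Real.exp (-t)) ≤
          2 * ε * (Real.exp (-t) * (1 - Real.exp (-t))) + 10 * chiK ε (Real.exp (-t)) := by
        linarith [h3.1, h4.2]
      have := mul_le_mul_of_nonneg_left this ht0
      linarith [this]
    have hint2 : IntegrableOn (fun t => 2 * ε * (t * (Real.exp (-t) * (1 - Real.exp (-t)))) +
        10 * (t * chiK ε (Real.exp (-t)))) (Ioi 0) := (hiA.const_mul _).add (hiK.const_mul _)
    have : ∫ t in Ioi (0 : ℝ), (t * Pp.eval (Real.exp (-t)) - t * Pm.eval (Real.exp (-t))) ≤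
        ∫ t in Ioi (0 : ℝ), (2 * ε * (t * (Real.exp (-t) * (1 - Real.exp (-t)))) +
          10 * (t * chiK ε (Real.exp (-t)))) :=
      setIntegral_mono_on (hiPp.sub hiPm) hint2 measurableSet_Ioi hdiff
    rw [integral_sub hiPp hiPm, integral_add (hiA.const_mul _) (hiK.const_mul _),
      integral_const_mul, integral_const_mul, hA, hK] at this
    linarith
  constructor
  · rw [abs_le]; constructor <;> linarith
  · rw [abs_le]; constructor <;> linarith

/-! ### Step 3: the sandwich and the theorem -/

/-- **Karamata's Tauberian theorem for Laplace transforms, index `ρ = 2`** (Feller XIII.5,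
Theorem 2, direction (5.15) ⟹ (5.16), for a measure with density `u ≥ 0` on `(0,∞)` and trivial
slowly varying factor): if `u(t)e^{-δt}` is integrable on `(0,∞)` for every `δ > 0` and
`δ² ω(δ) → A` as `δ ↓ 0` where `ω(δ) = ∫₀^∞ u(t)e^{-δt} dt`, then `(∫₀ᵀ u(t) dt)/T² → A/2`
(`= A/Γ(3) · 1`, i.e. `U(T) ∼ A T²/Γ(3)`) as `T → ∞`. [cite: Feller1971, XIII.5 Theorem 2 (ρ = 2)] -/
theorem tendsto_integral_div_sq (hu : ∀ t, 0 < t → 0 ≤ u t)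
    (hint : ∀ δ : ℝ, 0 < δ → IntegrableOn (fun t => u t * Real.exp (-(δ * t))) (Ioi 0))
    (hω : Tendsto (fun δ : ℝ => δ ^ 2 * laplace u δ) (𝓝[>] 0) (𝓝 A)) :
    Tendsto (fun T : ℝ => (∫ t in Ioc 0 T, u t) / T ^ 2) atTop (𝓝 (A / 2)) := by
  refine Metric.tendsto_nhds.mpr fun η hη => ?_
  -- choose Karamata's level ε with 22 ε |A| ≤ η/2
  set ε := min (1 / 8) (η / (44 * (|A| + 1))) with hε
  have hA1 : 0 < |A| + 1 := by positivity
  have hε0 : 0 < ε := lt_min (by norm_num) (by positivity)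
  have hε4 : ε < 1 / 4 := (min_le_left _ _).trans_lt (by norm_num)
  have hε1 : ε < 1 := hε4.trans (by norm_num)
  have hεη : 22 * ε * |A| ≤ η / 2 := by
    have h1 : ε ≤ η / (44 * (|A| + 1)) := min_le_right _ _
    rw [le_div_iff₀ (by positivity)] at h1
    nlinarith [abs_nonneg A]
  obtain ⟨Pm, Pp, hPm0, hPp0, hP⟩ := KaramataPolynomials_holds ε hε0 hε4
  obtain ⟨hLm, hLp⟩ := lam_sq_bounds hε0 hε1 hPm0 hPp0 hP
  have hTm := tendsto_integral_mul_eval_sq Pm hPm0 hint hω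
  have hTp := tendsto_integral_mul_eval_sq Pp hPp0 hint hω
  have h2 : 0 < η / 2 := by positivity
  filter_upwards [eventually_gt_atTop 0, Metric.tendsto_nhds.mp hTm _ h2,
    Metric.tendsto_nhds.mp hTp _ h2] with T hT hTmT hTpT
  rw [Real.dist_eq, abs_lt] at hTmT hTpT ⊢
  have hT2 : 0 < T ^ 2 := by positivity
  obtain ⟨hiJ, hJ⟩ := integral_mul_chiJ hint hT
  have hxmem : ∀ t ∈ Ioi (0 : ℝ), Real.exp (-(t / T)) ∈ Icc (0 : ℝ) 1 := fun t ht =>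
    ⟨(Real.exp_pos _).le, Real.exp_le_one_iff.mpr (by
      simp only [Set.mem_Ioi] at ht
      have := div_nonneg ht.le hT.le
      linarith)⟩
  -- sandwich
  have hlo : (∫ t in Ioi (0 : ℝ), u t * Pm.eval (Real.exp (-(t / T)))) ≤ ∫ t in Ioc 0 T, u t := by
    rw [← hJ]
    exact setIntegral_mono_on (integral_mul_eval Pm hPm0 hint hT).1 hiJ measurableSet_Ioi
      fun t ht => mul_le_mul_of_nonneg_left (hP _ (hxmem t ht)).1 (hu t ht)
  have hup : (∫ t in Ioc 0 T, u t) ≤ ∫ t in Ioi (0 : ℝ), u t * Pp.eval (Real.exp (-(t / T))) := by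
    rw [← hJ]
    exact setIntegral_mono_on hiJ (integral_mul_eval Pp hPp0 hint hT).1 measurableSet_Ioi
      fun t ht => mul_le_mul_of_nonneg_left (hP _ (hxmem t ht)).2.1 (hu t ht)
  have hlo' := div_le_div_of_nonneg_right hlo hT2.le
  have hup' := div_le_div_of_nonneg_right hup hT2.le
  -- |A Λ₂(P±) - A/2| ≤ η/2
  set lm := ∑ r ∈ Finset.range (Pm.natDegree + 1), Pm.coeff r / (r : ℝ) ^ 2 with hlm
  set lp := ∑ r ∈ Finset.range (Pp.natDegree + 1), Pp.coeff r / (r : ℝ) ^ 2 with hlp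
  have hm : |A * lm - A / 2| ≤ η / 2 := by
    rw [show A * lm - A / 2 = A * (lm - 1 / 2) by ring, abs_mul]
    nlinarith [abs_nonneg A, abs_nonneg (lm - 1 / 2)]
  have hp : |A * lp - A / 2| ≤ η / 2 := by
    rw [show A * lp - A / 2 = A * (lp - 1 / 2) by ring, abs_mul]
    nlinarith [abs_nonneg A, abs_nonneg (lp - 1 / 2)]
  rw [abs_le] at hm hp
  constructor <;> linarith [hTmT.1, hTpT.2, hm.1, hp.2]

end KaramataLaplace

/-- **Karamata's Tauberian theorem, `ρ = 2`, with the Laplace transform written out**: for `u ≥ 0`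
on `(0,∞)` with `u(t)e^{-δt}` integrable on `(0,∞)` for all `δ > 0`,
`δ² ∫₀^∞ u(t)e^{-δt}dt → A` (`δ ↓ 0`) implies `(∫₀ᵀ u)/T² → A/2` (`T → ∞`).
[cite: Feller1971, XIII.5 Theorem 2 (ρ = 2, (5.15) ⟹ (5.16))] -/
theorem karamata_tauberian_laplace_two {u : ℝ → ℝ} {A : ℝ} (hu : ∀ t, 0 < t → 0 ≤ u t)
    (hint : ∀ δ : ℝ, 0 < δ → IntegrableOn (fun t => u t * Real.exp (-(δ * t))) (Ioi 0))
    (hω : Tendsto (fun δ : ℝ => δ ^ 2 * ∫ t in Ioi (0 : ℝ), u t * Real.exp (-(δ * t)))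
      (𝓝[>] 0) (𝓝 A)) :
    Tendsto (fun T : ℝ => (∫ t in Ioc 0 T, u t) / T ^ 2) atTop (𝓝 (A / 2)) :=
  KaramataLaplace.tendsto_integral_div_sq hu hint hω

end Literature.Analysis.Asymptotics
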